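import Literature.AlgebraicGeometry.Motives.MorphismsToProjectiveSpace
import Literature.AlgebraicGeometry.Motives.ProjBaseChangeAny
import HarnessLib

/-!
# The morphism to `ℙ(ι)` defined by generating sections commutes with change of the base ring

Topic `AlgebraicGeometry/Motives`; namespace `Literature.AlgebraicGeometry.Motives.GeneratingSections`. THEOREMS ONLY (no
definition, no named fact, no instance, no `sorry`).

Let `k → L` be an algebra of commutative rings, `T` an `L`-scheme (`f' : T → Spec L`, hence a `k`-scheme through
`Spec L → Spec k`) and `D : GeneratingSections ι T` generating-sections data on `T` (★ `Motives/MorphismsToProjectiveSpace`: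
charts `U i = T_{sᵢ}` and ratios `s_j/s_i`; Hartshorne II Thm. 7.1 in chart form). The data define BOTH a morphism
`D.toProj f' : T → ℙ(ι)_L = Proj L[xᵢ]` over `L` and a morphism `D.toProj (f' ≫ Spec(k → L)) : T → ℙ(ι)_k` over `k`. We prove
that they correspond under the base-change morphism `ℙ(ι)_L → ℙ(ι)_k` (Mathlib `Proj.map` of `k[x] → L[x]`, the tree's
`ProjBaseChangeRing.mapGraded`; the square `ℙ(ι)_L = ℙ(ι)_k ×_k Spec L` is ★ `ProjBaseChangeRing.isPullback_projMap'`):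

* (private) `chartFun_map`, `awayMap_comp_eqToHom_comp_chartRingHom` — on the chart rings: `k[x] → L[x] → Γ(T', 𝒪)` is the
  `k`-chart ring map; `awayι_eq_eqToHom_comp_awayι`, `eqToHom_apply_awayMk` — transport of Mathlib's chart
  `D₊(t) = Spec (L[x]_{(t)})₀` along an equality `t = t'` of the localised element (here `φ(xᵢ) = xᵢ`);
* `chartι_comp_projMap` — `D₊(xᵢ) ⊂ ℙ(ι)_L → ℙ(ι)_k` is `Spec` of the base change of chart rings followed by `D₊(xᵢ) ⊂ ℙ(ι)_k`;
* **`toProj_comp_SpecMap_algebraMap`** — `D.toProj (f' ≫ Spec(k → L)) = D.toProj f' ≫ Proj.map (k[x] → L[x])`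
  (uniqueness in Hartshorne II Thm. 7.1 (b); base change of `Proj`, Görtz–Wedhorn I Remark 13.27 / (13.7.1); EGA II 4.2.10);
* `toProj_comp_projMap_toSpec` — hence `D.toProj f'` followed by the base change lies over `f' ≫ Spec(k → L)`.

This is bridge (B2) of the cell's (h2) leaf «fibrewise very ample ⇒ closed immersion near the fibre» (EGA III 4.7.1): with
`L = κ(𝔭)` it identifies the morphism of the fibre `X_𝔭 → ℙⁿ_{κ(𝔭)}` given by the restricted sections with the fibre of
`X → ℙⁿ_A` (via ★ `isPullback_projMap'`), the hypothesis shape of ★ `Morphisms/ClosedImmersionNearFibre`. Count-neutral capital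
(HC_CM is proved only modulo the 7 printed citations until rung 0 closes).

## References
* R. Hartshorne, *Algebraic Geometry* (1977), II Thm. 7.1 (b) (uniqueness of the `A`-morphism). [Hartshorne1977]
* U. Görtz, T. Wedhorn, *Algebraic Geometry I*, 2nd ed. (2020), Remark 13.27 with (13.7.1), pp. 382–384 (the formation of
  `Proj` is compatible with base change: `Proj(g^*𝒜) ≅ Proj 𝒜 ×_S S'`). [GortzWedhorn2020]
-/

noncomputable section

universe u

open CategoryTheory CategoryTheory.Limits AlgebraicGeometry HomogeneousLocalization TopologicalSpace Opposite
open MvPolynomial (X C)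
open Literature.AlgebraicGeometry.Motives.Segre

namespace Literature.AlgebraicGeometry.Motives

namespace GeneratingSections

attribute [local instance] MvPolynomial.gradedAlgebra

/-! ### Transport of the chart `D₊(t)` along an equality of the localised element -/

section Transport

variable {A σ : Type u} [CommRing A] [SetLike σ A] [AddSubgroupClass σ A] (ℬ : ℕ → σ) [GradedRing ℬ]

/-- For `s = t`, the chart `Spec (A_{(s)})₀ → Proj A` is the chart at `t` precomposed with the canonical identification
`Spec (A_{(s)})₀ = Spec (A_{(t)})₀` (an `eqToHom`). [folklore] -/
private theorem awayι_eq_eqToHom_comp_awayι {s t : A} (e : s = t) {d : ℕ} (hs : s ∈ ℬ d) (hd : 0 < d) :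
    Proj.awayι ℬ s hs hd =
      Spec.map (eqToHom (congrArg (fun u ↦ CommRingCat.of (Away ℬ u)) e.symm)) ≫ Proj.awayι ℬ t (e ▸ hs) hd := by
  subst e
  simp

/-- The identification `(A_{(s)})₀ = (A_{(t)})₀` for `s = t` sends `a/s^n` to `a/t^n`. [folklore] -/
private theorem eqToHom_apply_awayMk {s t : A} (e : s = t) {d : ℕ} (hs : s ∈ ℬ d) (n : ℕ) (a : A)
    (ha : a ∈ ℬ (n • d)) :
    (eqToHom (congrArg (fun u ↦ CommRingCat.of (Away ℬ u)) e)) (Away.mk ℬ hs n a ha) =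
      Away.mk ℬ (e ▸ hs) n a ha := by
  subst e
  simp

end Transport

/-! ### The chart rings under base change -/

section BaseChange

variable {ι : Type} {k L : Type u} [CommRing k] [CommRing L] [Algebra k L] {T T' : Scheme.{u}}
  (D : GeneratingSections ι T) (f' : T ⟶ Spec (.of L)) (i : ι) (g : T' ⟶ T) (hg : ⊤ ≤ g ⁻¹ᵁ D.U i)

/-- `φ(xᵢ) = xᵢ` for `φ = k[x] → L[x]`. [folklore] -/
private theorem mapGraded_X' : ProjBaseChangeRing.mapGraded k L ι (X i) = X i := by
  rw [ProjBaseChangeRing.mapGraded_apply, MvPolynomial.map_X]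

/-- On the polynomial chart rings: `k[x] → L[x] → Γ(T', 𝒪)` (the `L`-chart map of `f'`) is the `k`-chart map of
`f' ≫ Spec(k → L)` (both send `x_j ↦ s_j/s_i`, and constants through `T' → T → Spec L → Spec k`). [folklore] -/
private theorem chartFun_map (p : MvPolynomial ι k) :
    D.chartFun f' i g hg (MvPolynomial.map (algebraMap k L) p) =
      D.chartFun (f' ≫ Spec.map (CommRingCat.ofHom (algebraMap k L))) i g hg p := by
  revert p
  refine fun p ↦ congrFun (congrArg DFunLike.coe (?_ :
    (D.chartFun f' i g hg).comp (MvPolynomial.map (algebraMap k L)) =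
      D.chartFun (f' ≫ Spec.map (CommRingCat.ofHom (algebraMap k L))) i g hg)) p
  apply MvPolynomial.ringHom_ext
  · intro c
    rw [RingHom.comp_apply, MvPolynomial.map_C, chartFun_C, chartFun_C, ← Category.assoc, pull_SpecMap]
    rfl
  · intro j
    rw [RingHom.comp_apply, MvPolynomial.map_X, chartFun_X, chartFun_X]

/-- On the chart rings `(k[x]_{(xᵢ)})₀ → (L[x]_{(φ xᵢ)})₀ = (L[x]_{(xᵢ)})₀ → Γ(T', 𝒪)`: Mathlib's base-change map of
homogeneous localisations (`Away.map`) followed by the identification `φ(xᵢ) = xᵢ` and the `L`-chart ring map is the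
`k`-chart ring map. [folklore] -/
private theorem awayMap_comp_eqToHom_comp_chartRingHom :
    CommRingCat.ofHom (Away.map (ProjBaseChangeRing.mapGraded k L ι) (X i)) ≫
        eqToHom (congrArg (fun u ↦ CommRingCat.of (Away (grading ι L) u)) (mapGraded_X' (k := k) (L := L) i)) ≫
          CommRingCat.ofHom (D.chartRingHom f' i g hg) =
      CommRingCat.ofHom (D.chartRingHom (f' ≫ Spec.map (CommRingCat.ofHom (algebraMap k L))) i g hg) := by
  ext x
  obtain ⟨n, a, ha, rfl⟩ := Away.mk_surjective _ (X_mem k i) x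
  show D.chartRingHom f' i g hg (eqToHom (congrArg (fun u ↦ CommRingCat.of (Away (grading ι L) u))
      (mapGraded_X' (k := k) (L := L) i))
        (Away.map (ProjBaseChangeRing.mapGraded k L ι) (X i) (Away.mk _ (X_mem k i) n a ha))) =
    D.chartRingHom (f' ≫ Spec.map (CommRingCat.ofHom (algebraMap k L))) i g hg (Away.mk _ (X_mem k i) n a ha)
  rw [Away.map_mk, eqToHom_apply_awayMk (grading ι L) (mapGraded_X' (k := k) (L := L) i), chartRingHom_awayMk,
    chartRingHom_awayMk]
  exact D.chartFun_map f' i g hg a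

/-- The standard chart of `ℙ(ι)_L` at `xᵢ` followed by the base change `ℙ(ι)_L → ℙ(ι)_k` is `Spec` of the base-change map
of chart rings followed by the standard chart of `ℙ(ι)_k` (Mathlib `Proj.awayι_comp_map`, transported along `φ(xᵢ) = xᵢ`);
the chart form of `ℙ(ι)_L = ℙ(ι)_k ×_k Spec L`. [cite: GortzWedhorn2020, Remark 13.27, (13.7.1) (pp. 382–384)] -/
theorem chartι_comp_projMap :
    chartι L i ≫ Proj.map (ProjBaseChangeRing.mapGraded k L ι) (ProjBaseChangeRing.irrelevant_le_map k L ι) =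
      Spec.map (eqToHom (congrArg (fun u ↦ CommRingCat.of (Away (grading ι L) u)) (mapGraded_X' (k := k) (L := L) i))) ≫
        Spec.map (CommRingCat.ofHom (Away.map (ProjBaseChangeRing.mapGraded k L ι) (X i))) ≫ chartι k i := by
  have h := Proj.awayι_comp_map (ProjBaseChangeRing.mapGraded k L ι) (ProjBaseChangeRing.irrelevant_le_map k L ι)
    zero_lt_one (X i) (X_mem k i)
  rw [awayι_eq_eqToHom_comp_awayι (grading ι L) (mapGraded_X' (k := k) (L := L) i), Category.assoc] at h
  -- the two identifications compose to the identity
  have h2 : Spec.map (eqToHom (congrArg (fun u ↦ CommRingCat.of (Away (grading ι L) u))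
        (mapGraded_X' (k := k) (L := L) i))) ≫
      Spec.map (eqToHom (congrArg (fun u ↦ CommRingCat.of (Away (grading ι L) u))
        (mapGraded_X' (k := k) (L := L) i).symm)) = 𝟙 _ := by
    rw [← Spec.map_comp, eqToHom_trans, eqToHom_refl, Spec.map_id]
  calc chartι L i ≫ Proj.map (ProjBaseChangeRing.mapGraded k L ι) (ProjBaseChangeRing.irrelevant_le_map k L ι)
      = (Spec.map (eqToHom (congrArg (fun u ↦ CommRingCat.of (Away (grading ι L) u))
            (mapGraded_X' (k := k) (L := L) i))) ≫
          Spec.map (eqToHom (congrArg (fun u ↦ CommRingCat.of (Away (grading ι L) u))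
            (mapGraded_X' (k := k) (L := L) i).symm))) ≫
          Proj.awayι (grading ι L) (X i) ((mapGraded_X' (k := k) (L := L) i) ▸
            (ProjBaseChangeRing.mapGraded k L ι).2 (X_mem k i)) zero_lt_one ≫
          Proj.map (ProjBaseChangeRing.mapGraded k L ι) (ProjBaseChangeRing.irrelevant_le_map k L ι) := by
        rw [h2, Category.id_comp]
    _ = _ := by
        rw [Category.assoc, h]

/-- **The morphism to `ℙ(ι)` defined by generating sections commutes with base change of the ring**: for an `L`-scheme
`T` (`k → L` an algebra) and generating-sections data `D` on `T`, the `k`-morphism `T → ℙ(ι)_k` defined by `D` is the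
`L`-morphism `T → ℙ(ι)_L` defined by `D` followed by `ℙ(ι)_L → ℙ(ι)_k` (uniqueness in Hartshorne II Thm. 7.1 (b); checked on
the charts `U i → D₊(xᵢ)`). [cite: Hartshorne1977, II Thm. 7.1 (b)] [cite: GortzWedhorn2020, Remark 13.27, (13.7.1) (pp. 382–384)] -/
theorem toProj_comp_SpecMap_algebraMap :
    D.toProj (f' ≫ Spec.map (CommRingCat.ofHom (algebraMap k L))) =
      D.toProj f' ≫ Proj.map (ProjBaseChangeRing.mapGraded k L ι) (ProjBaseChangeRing.irrelevant_le_map k L ι) := by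
  refine Scheme.Cover.hom_ext D.cover _ _ fun i ↦ ?_
  rw [cover_f, ι_toProj, ι_toProj_assoc, chart, chart, chartMap, chartMap, Category.assoc, Category.assoc,
    chartι_comp_projMap, ← Spec.map_comp_assoc, ← Spec.map_comp_assoc, awayMap_comp_eqToHom_comp_chartRingHom]

/-- The base-changed morphism `T → ℙ(ι)_L → ℙ(ι)_k` lies over `T → Spec L → Spec k` (it is the `k`-morphism of the
generating sections). [cite: Hartshorne1977, II Thm. 7.1 (b)] -/
theorem toProj_comp_projMap_toSpec :
    (D.toProj f' ≫ Proj.map (ProjBaseChangeRing.mapGraded k L ι) (ProjBaseChangeRing.irrelevant_le_map k L ι)) ≫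
        toSpec ι k = f' ≫ Spec.map (CommRingCat.ofHom (algebraMap k L)) := by
  rw [← toProj_comp_SpecMap_algebraMap, toProj_toSpec]

end BaseChange

end GeneratingSections

end Literature.AlgebraicGeometry.Motives
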